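import Summits.KontsevichZagierPeriods.Zeta5Search.Barrier.ConeGammaCuspPeriodKink

/-!
# ζ(5) search — BARRIER: THE GREEDY WEIGHTS OF THE PERIOD PATTERN FUNCTION ARE ORIENTED AND BOUNDED BY MEMBER COUNTS

HONEST FRAMING (cell `pub-zeta5`): systematic search; no irrationality claim unless kernel-certified. MODEL objects
under Brown–Zudilin's (28)+(30) accounting ([BZ22] = arXiv:2210.03391; (28) observed, not proved); nothing here is a
statement about `ζ(5)`, any `γ` of record, the cone's supremum (C2 OPEN) or the VALUE of any weight at a named
direction (DATA of the cell); S-E stays CONJECTURED; records in print UNMOVED. Prover P2 g31, item «ONE SET FUNCTION»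
(INBOX 2026-08-27), file (5): the wall orientation of P2 g26 (`torusN_floor_step`) read on the greedy vectors.

* **`junction_greedy_weight_bounds`** — at a junction `b ∈ bkpts a T` with pattern data `M, f` (agreement hypothesis
  `hf`) and a reference `δ₀` generic on all 28 forms, the junction greedy weight
  `w_k = f(M ∩ P≤(k)) − f(M ∩ P<(k))` of EVERY form `k` is a SIMPLE FLIP: `w_k ∈ [0, 1]` if `k ∈ F`, `w_k ∈ [−1, 0]` if
  `k ∉ F` (the two prefix patterns are the saving just after and just before the flip of `k` alone along the local line
  of `δ₀`; one floor moves, `torusN_floor_step`);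
* **`period_weight_bounds`** — hence the GLOBAL greedy weight `W_k = F(P≤(k)) − F(P<(k))` of the period pattern
  function (`period_weight_eq_sum_junction_weights`) satisfies `0 ≤ W_k ≤ #{m : k ∈ M m}` on `F` and
  `−#{m : k ∈ M m} ≤ W_k ≤ 0` off `F`; **`period_weight_abs_le`** — if every `M m` consists of members of `b_m`
  (`b_m·h_k(a) ∈ ℤ`), then `|W_k| ≤ T·h_k(a)` (P2 g30's `card_member_junctions`): the greedy vectors of `F` obey the
  SAME orientation and bounds as P2 g29/g30's chamber weights `𝒥` (they define the same functional on `ℝ⁸`; as vectors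
  of `ℝ²⁸` they need not coincide, the 28 rates being linearly dependent).
DESK (DATA, `HOME/pub-zeta5-p2/g31/alg/periodlovasz.py` (L2)): 260 generic references at the four named directions,
0 orientation violations in 7 280 weights, 0 bound violations. NOT here: any weight at a named direction; `γ`, C2, S-E,
`ζ(5)`.
-/

noncomputable section

open Set MeasureTheory Finset
open scoped Topology

namespace Summit.KontsevichZagierPeriods.Zeta5Search.Barrier.ConeGamma

/-! ### Junction greedy weights are simple flips -/

/-- **JUNCTION GREEDY WEIGHTS ARE SIMPLE FLIPS.** Junction `b ∈ bkpts a T` (all forms of `a` positive), finset `M`,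
pattern function `f` through which the saving factors near `θ_b`, reference `δ₀` with pairwise distinct rates
`ρ_l = φ_l(δ₀)/h_l(a)` on all 28 forms. Then for every form `k` the greedy weight
`w_k = f(M ∩ {ρ_k ≤ ρ}) − f(M ∩ {ρ_k < ρ})` lies in `[0, 1]` if `k ∈ F` and in `[−1, 0]` if `k ∉ F`. -/
theorem junction_greedy_weight_bounds {a : Dir} (hpos : ∀ k, 0 < h28 a k) {T b : ℝ} (hb : b ∈ bkpts a T)
    {M : Finset (Fin 28)} {f : Finset (Fin 28) → ℝ}
    (hf : ∀ Δ : Fin 8 → ℝ, (∀ k, |phiForm Δ k| < 1) → (∀ k, |phiForm Δ k| < wallDist a T) →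
      (torusN (b • sParam a + Δ) : ℝ) = f (M.filter fun k => 0 ≤ phiForm Δ k))
    {δ₀ : Fin 8 → ℝ} (hgen : ∀ k l : Fin 28, k ≠ l → phiForm δ₀ k / h28 a k ≠ phiForm δ₀ l / h28 a l)
    (k : Fin 28) :
    (k ∈ FIdx →
      0 ≤ f (M.filter fun l => phiForm δ₀ k / h28 a k ≤ phiForm δ₀ l / h28 a l) -
          f (M.filter fun l => phiForm δ₀ k / h28 a k < phiForm δ₀ l / h28 a l) ∧
      f (M.filter fun l => phiForm δ₀ k / h28 a k ≤ phiForm δ₀ l / h28 a l) -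
          f (M.filter fun l => phiForm δ₀ k / h28 a k < phiForm δ₀ l / h28 a l) ≤ 1) ∧
    (k ∉ FIdx →
      -1 ≤ f (M.filter fun l => phiForm δ₀ k / h28 a k ≤ phiForm δ₀ l / h28 a l) -
          f (M.filter fun l => phiForm δ₀ k / h28 a k < phiForm δ₀ l / h28 a l) ∧
      f (M.filter fun l => phiForm δ₀ k / h28 a k ≤ phiForm δ₀ l / h28 a l) -
          f (M.filter fun l => phiForm δ₀ k / h28 a k < phiForm δ₀ l / h28 a l) ≤ 0) := by
  classical
  obtain ⟨ρ, hρ⟩ : ∃ ρ : Fin 28 → ℝ, ∀ l, ρ l = phiForm δ₀ l / h28 a l := ⟨_, fun _ => rfl⟩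
  simp only [← hρ]
  have hgenρ : ∀ l, l ≠ k → ρ l ≠ ρ k := fun l hl => by rw [hρ, hρ]; exact hgen l k hl
  -- an admissible scale
  have hK := clusterBound_pos hpos δ₀
  have hd := wallDist_pos a T
  set η : ℝ := min 1 (wallDist a T) / (2 * clusterBound a δ₀) with hη
  have hηpos : 0 < η := div_pos (lt_min one_pos hd) (by positivity)
  have hηK : η * clusterBound a δ₀ = min 1 (wallDist a T) / 2 := by rw [hη]; field_simp
  have h1 : η * clusterBound a δ₀ < 1 := by rw [hηK]; linarith [min_le_left (1 : ℝ) (wallDist a T)]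
  have h2 : η * clusterBound a δ₀ < wallDist a T := by rw [hηK]; linarith [min_le_right (1 : ℝ) (wallDist a T)]
  -- a gap `ε` below the distance of `ρ_k` to the other 27 rates and to the window edge
  set W := clusterWidth a δ₀ with hW
  have hρW : |ρ k| < W := by rw [hρ]; exact abs_flip_lt_clusterWidth hpos δ₀ k
  let V : Finset ℝ := insert (W - |ρ k|) ((Finset.univ.erase k).image fun l => |ρ l - ρ k|)
  have hVne : V.Nonempty := ⟨_, Finset.mem_insert_self _ _⟩
  have hVpos : ∀ v ∈ V, 0 < v := fun v hv => by
    rcases Finset.mem_insert.mp hv with rfl | hv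
    · linarith
    · obtain ⟨l, hl, rfl⟩ := Finset.mem_image.mp hv
      exact abs_pos.mpr (sub_ne_zero.mpr (hgenρ l (Finset.ne_of_mem_erase hl)))
  set ε : ℝ := V.min' hVne / 2 with hεdef
  have hmin : 0 < V.min' hVne := hVpos _ (Finset.min'_mem V hVne)
  have hε : 0 < ε := by rw [hεdef]; linarith
  have hεW : 2 * ε ≤ W - |ρ k| := by
    rw [hεdef]; have := Finset.min'_le V _ (Finset.mem_insert_self _ _); linarith
  have hεl : ∀ l, l ≠ k → 2 * ε ≤ |ρ l - ρ k| := fun l hl => by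
    rw [hεdef]
    have := Finset.min'_le V _ (Finset.mem_insert_of_mem
      (Finset.mem_image.mpr ⟨l, Finset.mem_erase.mpr ⟨hl, Finset.mem_univ _⟩, rfl⟩))
    linarith
  -- the two local times, just after and just before the flip of `k`
  set x : ℝ := -ρ k + ε with hx
  set x' : ℝ := -ρ k - ε with hx'
  have hxW : |x| ≤ W := by
    rw [hx, abs_le]; constructor <;> linarith [le_abs_self (ρ k), neg_abs_le (ρ k)]
  have hx'W : |x'| ≤ W := by
    rw [hx', abs_le]; constructor <;> linarith [le_abs_self (ρ k), neg_abs_le (ρ k)]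
  -- the threshold sets at `x` and `x'` are the two prefix sets of `k`
  have hSx : M.filter (fun l => -(phiForm δ₀ l / h28 a l) ≤ x) = M.filter fun l => ρ k ≤ ρ l := by
    refine Finset.filter_congr fun l _ => ?_
    rw [← hρ, hx]
    by_cases hlk : l = k
    · subst hlk; constructor <;> intro <;> linarith
    · have hg := hεl l hlk
      constructor
      · intro h
        by_contra hlt
        rw [abs_of_neg (by linarith [not_le.mp hlt])] at hg
        linarith [not_le.mp hlt]
      · intro h
        have hne := hgenρ l hlk
        rw [abs_of_pos (sub_pos.mpr (lt_of_le_of_ne h (Ne.symm hne)))] at hg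
        linarith
  have hSx' : M.filter (fun l => -(phiForm δ₀ l / h28 a l) ≤ x') = M.filter fun l => ρ k < ρ l := by
    refine Finset.filter_congr fun l _ => ?_
    rw [← hρ, hx']
    by_cases hlk : l = k
    · subst hlk; constructor <;> intro <;> linarith
    · have hg := hεl l hlk
      constructor
      · intro h; linarith
      · intro h
        rw [abs_of_pos (sub_pos.mpr h)] at hg
        linarith
  -- the two values of the saving
  have hv := torusN_line_eq_pattern hpos hf δ₀ hηpos h1 h2 hxW
  have hv' := torusN_line_eq_pattern hpos hf δ₀ hηpos h1 h2 hx'W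
  rw [hSx] at hv
  rw [hSx'] at hv'
  rw [← hv, ← hv']
  -- the floors: only form `k` can move between the two points, by `+1`, and only if it is a member
  obtain ⟨hΔ1, hΔ2⟩ := disp_small hpos δ₀ hηpos h1 h2 hxW (T := T)
  obtain ⟨hΔ1', hΔ2'⟩ := disp_small hpos δ₀ hηpos h1 h2 hx'W (T := T)
  have hform : ∀ l y, phiForm (η • (y • sParam a + δ₀)) l = η * h28 a l * (y + ρ l) := fun l y => by
    have hl : h28 a l ≠ 0 := (hpos l).ne'
    have e : h28 a l * (y + phiForm δ₀ l / h28 a l) = y * h28 a l + phiForm δ₀ l := by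
      rw [mul_add, mul_div_cancel₀ _ hl, mul_comm]
    rw [phiForm_disp, hρ, mul_assoc, e]
  have hother : ∀ l, l ≠ k →
      ⌊phiForm (b • sParam a + η • (x • sParam a + δ₀)) l⌋ =
        ⌊phiForm (b • sParam a + η • (x' • sParam a + δ₀)) l⌋ := by
    intro l hlk
    obtain ⟨hp, hn, hnon⟩ := floor_phiForm_bkpt_add hb hΔ1 hΔ2 l
    obtain ⟨hp', hn', hnon'⟩ := floor_phiForm_bkpt_add hb hΔ1' hΔ2' l
    by_cases hmem : ∃ z : ℤ, b * h28 a l = z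
    · obtain ⟨z, hz⟩ := hmem
      have hg := hεl l hlk
      have hηl : 0 < η * h28 a l := mul_pos hηpos (hpos l)
      rcases lt_or_gt_of_ne (hgenρ l hlk) with hlt | hgt
      · -- `ρ l < ρ k`: form `l` is below at both points
        rw [abs_of_neg (sub_neg.mpr hlt)] at hg
        have s1 : phiForm (η • (x • sParam a + δ₀)) l < 0 := by
          rw [hform, hx]; exact mul_neg_of_pos_of_neg hηl (by linarith)
        have s2 : phiForm (η • (x' • sParam a + δ₀)) l < 0 := by
          rw [hform, hx']; exact mul_neg_of_pos_of_neg hηl (by linarith)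
        rw [hn z hz s1, hn' z hz s2]
      · -- `ρ k < ρ l`: form `l` is above at both points
        rw [abs_of_pos (sub_pos.mpr hgt)] at hg
        have s1 : 0 < phiForm (η • (x • sParam a + δ₀)) l := by
          rw [hform, hx]; exact mul_pos hηl (by linarith)
        have s2 : 0 < phiForm (η • (x' • sParam a + δ₀)) l := by
          rw [hform, hx']; exact mul_pos hηl (by linarith)
        rw [hp z hz s1, hp' z hz s2]
    · push Not at hmem
      rw [hnon hmem, hnon' hmem]
  have hηk : 0 < η * h28 a k := mul_pos hηpos (hpos k)
  have sk : 0 < phiForm (η • (x • sParam a + δ₀)) k := by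
    rw [hform, hx]; exact mul_pos hηk (by linarith)
  have sk' : phiForm (η • (x' • sParam a + δ₀)) k < 0 := by
    rw [hform, hx']; exact mul_neg_of_pos_of_neg hηk (by linarith)
  by_cases hmemk : ∃ z : ℤ, b * h28 a k = z
  · -- `k` is a member: exactly one floor step
    obtain ⟨z, hz⟩ := hmemk
    have hk₀ : ⌊phiForm (b • sParam a + η • (x • sParam a + δ₀)) k⌋ =
        ⌊phiForm (b • sParam a + η • (x' • sParam a + δ₀)) k⌋ + 1 := by
      rw [(floor_phiForm_bkpt_add hb hΔ1 hΔ2 k).1 z hz sk, (floor_phiForm_bkpt_add hb hΔ1' hΔ2' k).2.1 z hz sk']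
      ring
    have hstep := torusN_floor_step hk₀ hother
    refine ⟨fun hkF => ?_, fun hkF => ?_⟩
    · obtain ⟨e1, e2⟩ := hstep.1 hkF
      have c1 := (Int.cast_le (R := ℝ)).mpr e1
      have c2 := (Int.cast_le (R := ℝ)).mpr e2
      rw [Int.cast_add, Int.cast_one] at c2
      constructor <;> linarith
    · obtain ⟨e1, e2⟩ := hstep.2 hkF
      have c1 := (Int.cast_le (R := ℝ)).mpr e1
      have c2 := (Int.cast_le (R := ℝ)).mpr e2
      rw [Int.cast_add, Int.cast_one] at c2
      constructor <;> linarith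
  · -- `k` is not a member: no floor moves, the two values agree
    push Not at hmemk
    have hkk : ⌊phiForm (b • sParam a + η • (x • sParam a + δ₀)) k⌋ =
        ⌊phiForm (b • sParam a + η • (x' • sParam a + δ₀)) k⌋ := by
      rw [(floor_phiForm_bkpt_add hb hΔ1 hΔ2 k).2.2 hmemk, (floor_phiForm_bkpt_add hb hΔ1' hΔ2' k).2.2 hmemk]
    have hall : ∀ l, ⌊phiForm (b • sParam a + η • (x • sParam a + δ₀)) l⌋ =
        ⌊phiForm (b • sParam a + η • (x' • sParam a + δ₀)) l⌋ := fun l => by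
      by_cases hlk : l = k
      · rw [hlk]; exact hkk
      · exact hother l hlk
    have e1 := torusN_mono_of_floors (fun l _ => (hall l).le) (fun l _ => (hall l).ge)
    have e2 := torusN_mono_of_floors (fun l _ => (hall l).ge) (fun l _ => (hall l).le)
    have e : (torusN (b • sParam a + η • (x • sParam a + δ₀)) : ℝ) =
        torusN (b • sParam a + η • (x' • sParam a + δ₀)) := Int.cast_inj.mpr (le_antisymm e1 e2)
    refine ⟨fun _ => ⟨by linarith, by linarith⟩, fun _ => ⟨by linarith, by linarith⟩⟩

/-! ### The global greedy weights are oriented and bounded by member counts -/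

/-- **THE GLOBAL GREEDY WEIGHTS ARE ORIENTED AND BOUNDED.** With the data of `cuspSlope_eq_lovasz_period` and a
reference `δ₀` generic on all 28 forms: the greedy weight `W_k = F(P≤(k)) − F(P<(k))` of the period pattern function
satisfies `0 ≤ W_k ≤ #{m : k ∈ M m}` for `k ∈ F` and `−#{m : k ∈ M m} ≤ W_k ≤ 0` for `k ∉ F` (`m` over the junctions
of one period). -/
theorem period_weight_bounds {a : Dir} (hpos : ∀ k, 0 < h28 a k) {T : ℝ}
    {M : ℕ → Finset (Fin 28)} {f : ℕ → Finset (Fin 28) → ℝ}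
    (hf : ∀ m, m + 1 < (bkpts a T).card → ∀ Δ : Fin 8 → ℝ, (∀ k, |phiForm Δ k| < 1) →
      (∀ k, |phiForm Δ k| < wallDist a T) →
        (torusN (bkpt a T m • sParam a + Δ) : ℝ) = f m ((M m).filter fun k => 0 ≤ phiForm Δ k))
    {F : Finset (Fin 28) → ℝ} (hF : ∀ A, F A = ∑ m ∈ Finset.range ((bkpts a T).card - 1), f m (A ∩ M m))
    {δ₀ : Fin 8 → ℝ} (hgen : ∀ k l : Fin 28, k ≠ l → phiForm δ₀ k / h28 a k ≠ phiForm δ₀ l / h28 a l)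
    (k : Fin 28) :
    (k ∈ FIdx →
      0 ≤ F (Finset.univ.filter fun l => phiForm δ₀ k / h28 a k ≤ phiForm δ₀ l / h28 a l) -
          F (Finset.univ.filter fun l => phiForm δ₀ k / h28 a k < phiForm δ₀ l / h28 a l) ∧
      F (Finset.univ.filter fun l => phiForm δ₀ k / h28 a k ≤ phiForm δ₀ l / h28 a l) -
          F (Finset.univ.filter fun l => phiForm δ₀ k / h28 a k < phiForm δ₀ l / h28 a l) ≤
        (((Finset.range ((bkpts a T).card - 1)).filter fun m => k ∈ M m).card : ℝ)) ∧
    (k ∉ FIdx →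
      -((((Finset.range ((bkpts a T).card - 1)).filter fun m => k ∈ M m).card : ℝ)) ≤
        F (Finset.univ.filter fun l => phiForm δ₀ k / h28 a k ≤ phiForm δ₀ l / h28 a l) -
          F (Finset.univ.filter fun l => phiForm δ₀ k / h28 a k < phiForm δ₀ l / h28 a l) ∧
      F (Finset.univ.filter fun l => phiForm δ₀ k / h28 a k ≤ phiForm δ₀ l / h28 a l) -
          F (Finset.univ.filter fun l => phiForm δ₀ k / h28 a k < phiForm δ₀ l / h28 a l) ≤ 0) := by
  classical
  rw [period_weight_eq_sum_junction_weights hF hgen k]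
  have hjun : ∀ m ∈ (Finset.range ((bkpts a T).card - 1)).filter (fun m => k ∈ M m),
      (k ∈ FIdx → 0 ≤ f m ((M m).filter fun l => phiForm δ₀ k / h28 a k ≤ phiForm δ₀ l / h28 a l) -
          f m ((M m).filter fun l => phiForm δ₀ k / h28 a k < phiForm δ₀ l / h28 a l) ∧
        f m ((M m).filter fun l => phiForm δ₀ k / h28 a k ≤ phiForm δ₀ l / h28 a l) -
          f m ((M m).filter fun l => phiForm δ₀ k / h28 a k < phiForm δ₀ l / h28 a l) ≤ 1) ∧
      (k ∉ FIdx → -1 ≤ f m ((M m).filter fun l => phiForm δ₀ k / h28 a k ≤ phiForm δ₀ l / h28 a l) -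
          f m ((M m).filter fun l => phiForm δ₀ k / h28 a k < phiForm δ₀ l / h28 a l) ∧
        f m ((M m).filter fun l => phiForm δ₀ k / h28 a k ≤ phiForm δ₀ l / h28 a l) -
          f m ((M m).filter fun l => phiForm δ₀ k / h28 a k < phiForm δ₀ l / h28 a l) ≤ 0) := by
    intro m hm
    have hm' : m + 1 < (bkpts a T).card := by have := Finset.mem_range.mp (Finset.mem_filter.mp hm).1; omega
    exact junction_greedy_weight_bounds hpos (bkpt_mem (by omega)) (hf m hm') hgen k
  refine ⟨fun hk => ⟨Finset.sum_nonneg fun m hm => ((hjun m hm).1 hk).1, ?_⟩,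
    fun hk => ⟨?_, Finset.sum_nonpos fun m hm => ((hjun m hm).2 hk).2⟩⟩
  · calc _ ≤ ∑ m ∈ (Finset.range ((bkpts a T).card - 1)).filter (fun m => k ∈ M m), (1 : ℝ) :=
          Finset.sum_le_sum fun m hm => ((hjun m hm).1 hk).2
      _ = _ := by simp
  · calc -((((Finset.range ((bkpts a T).card - 1)).filter fun m => k ∈ M m).card : ℝ))
          = ∑ m ∈ (Finset.range ((bkpts a T).card - 1)).filter (fun m => k ∈ M m), (-1 : ℝ) := by simp
      _ ≤ _ := Finset.sum_le_sum fun m hm => ((hjun m hm).2 hk).1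

open scoped Classical in
/-- **… HENCE `|W_k| ≤ T·h_k(a)`** when every `M m` consists of members of the junction `b_m` (`b_m·h_k(a) ∈ ℤ` for
`k ∈ M m`; `T > 0` a period): form `k` is a member of exactly `T·h_k(a)` junctions of one period
(`card_member_junctions`), so the global greedy weight is bounded by the member count, as P2 g30's chamber weights. -/
theorem period_weight_abs_le {a : Dir} (hpos : ∀ k, 0 < h28 a k) {T : ℝ} (hT : 0 < T)
    (hper : ∀ k : Fin 28, ∃ z : ℤ, T * h28 a k = z)
    {M : ℕ → Finset (Fin 28)} {f : ℕ → Finset (Fin 28) → ℝ}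
    (hM : ∀ m, m + 1 < (bkpts a T).card → ∀ k ∈ M m, ∃ z : ℤ, bkpt a T m * h28 a k = z)
    (hf : ∀ m, m + 1 < (bkpts a T).card → ∀ Δ : Fin 8 → ℝ, (∀ k, |phiForm Δ k| < 1) →
      (∀ k, |phiForm Δ k| < wallDist a T) →
        (torusN (bkpt a T m • sParam a + Δ) : ℝ) = f m ((M m).filter fun k => 0 ≤ phiForm Δ k))
    {F : Finset (Fin 28) → ℝ} (hF : ∀ A, F A = ∑ m ∈ Finset.range ((bkpts a T).card - 1), f m (A ∩ M m))
    {δ₀ : Fin 8 → ℝ} (hgen : ∀ k l : Fin 28, k ≠ l → phiForm δ₀ k / h28 a k ≠ phiForm δ₀ l / h28 a l)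
    (k : Fin 28) :
    |F (Finset.univ.filter fun l => phiForm δ₀ k / h28 a k ≤ phiForm δ₀ l / h28 a l) -
        F (Finset.univ.filter fun l => phiForm δ₀ k / h28 a k < phiForm δ₀ l / h28 a l)| ≤ T * h28 a k := by
  classical
  have hb := period_weight_bounds hpos hf hF hgen k (T := T)
  -- the junctions listing `k` are among the `T·h_k` junctions where `k` is a member
  have hsub : (Finset.range ((bkpts a T).card - 1)).filter (fun m => k ∈ M m) ⊆
      (Finset.range ((bkpts a T).card - 1)).filter fun m => ∃ z : ℤ, bkpt a T m * h28 a k = z := by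
    intro m hm
    obtain ⟨hmr, hkm⟩ := Finset.mem_filter.mp hm
    have hm' : m + 1 < (bkpts a T).card := by have := Finset.mem_range.mp hmr; omega
    exact Finset.mem_filter.mpr ⟨hmr, hM m hm' k hkm⟩
  have hcard : ((((Finset.range ((bkpts a T).card - 1)).filter fun m => k ∈ M m).card : ℕ) : ℝ) ≤ T * h28 a k := by
    rw [← card_member_junctions hpos hT k (hper k)]
    exact_mod_cast Finset.card_le_card hsub
  rw [abs_le]
  by_cases hk : k ∈ FIdx
  · obtain ⟨h0, h1⟩ := hb.1 hk
    constructor <;> linarith [mul_pos hT (hpos k)]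
  · obtain ⟨h0, h1⟩ := hb.2 hk
    constructor <;> linarith [mul_pos hT (hpos k)]

end Summit.KontsevichZagierPeriods.Zeta5Search.Barrier.ConeGamma

end
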